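import Summits.QuantumFields.BalabanUV.T4Continuum.Support.VariationalVectorWeitzenbock
import Summits.QuantumFields.BalabanUV.T4Continuum.Support.VariationalColourInterpolant

/-!
# T⁴ programme, spine node NE2 (U1a), lane P2 — «V-REG PREP»: THE OPERATOR WEITZENBÖCK IDENTITY and VECTOR BOCHNER for `E`-valued 1-forms
# (the `G`-independent prerequisites of row V-REG of `t4/skeletons/NE2-t4-ne2-p2.md` §2.E «Weitzenböck∕Bochner on 1-forms + Euler–Lagrange;
# curvature commutators = plaquette defects»; model level, ONE level, every torus)

NE2 formalisation swarm `b2b-balaban-t4-ne2-formalise-*`, leaf prover 09 GEN 6 (`prover-b2b-balaban-t4-ne2-formalise-leaf-09-g6-0`); journal INTENT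
CLAIMS.log 2026-08-20 13:32Z «V-REG PREP».  On top of this lineage's `VariationalColourBochner` (p215065: `Dirv`, `DirAdjv`, `negLapv`, `ipv`, `ipv_DirAdjv`,
`Dirv_DirAdjv_comm`, `norm_kappa1v_le`, **`hessian_le`**) and `VariationalVectorWeitzenbock` (p218860: `divV`, `divSq`, the quadratic-form identity
`weitzenbock`), and of the road owner's `VariationalVectorForm.{cdV, curlV, curlSq}` (p216339) — BY NAME.

THE STATEMENT (model level; lattice units).  `E` a complex Hilbert space; 1-forms `W : Tor N → Fin d → E`; transports `R : Tor N → Fin d → (E →L[ℂ] E)` DATA;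
`D_μ`, `D_μ†` the covariant forward difference and its formal adjoint, `[D_ν, D_μ†] = D_νD_μ† − D_μ†D_ν`.
 * §1 THE OPERATORS on 1-forms: `roughOpV R W x ν := (D†D W_ν)(x)` (the rough Laplacian, `negLapv` per component), `curlAdjCurlV R W x ν := Σ_μ (D_μ† curl_{μν}W)(x)`,
   `gradDivV R W x ν := (D_ν div_R W)(x)`, `commV R W x ν := Σ_μ ([D_ν, D_μ†] W_μ)(x)`;
 * §2 **`weitzenbockOp`** (EXACT, ANY transports, pointwise): `roughOpV = curlAdjCurlV + gradDivV − commV` — the OPERATOR behind p218860's form identity and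
   the function-world twin of P1's matrix identity `LatticeWeitzenbock.weitzenbock` (not imported, different carrier);
 * §3 THE FIRST-VARIATION IDENTITIES (why these are the Euler–Lagrange operators of the road's form `½·curlSq + G`):
   `Σ_ν ⟨V_ν, curlAdjCurlV W ·ν⟩_{ℓ²} = ½·Σ_{μ,ν} ⟨curl_{μν}V, curl_{μν}W⟩_{ℓ²}` (`sum_ipv_curlAdjCurlV`; at `V = W` the real number `curlSq∕2`) and
   `Σ_ν ⟨V_ν, gradDivV W ·ν⟩_{ℓ²} = ⟨div V, div W⟩_{ℓ²}` (`sum_ipv_gradDivV`; at `V = W` the number `divSq`);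
 * §4 **VECTOR BOCHNER** for UNITARY transports with operator plaquette defect `≤ p` (the binders of `hessian_le`, verbatim):
   `Σ_κ Σ_{μ,ν} ‖D_μD_νW_κ‖²_{ℓ²} ≤ 2·Σ_κ ‖(D†D W)_κ‖²_{ℓ²} + 2pd·Σ‖D_μW_κ‖² + p²d²·nsqV W` (`hessianV_le`; on the level-`n` torus with leaf-03-g4's `roughV`,
   `hessianV_le_roughV`); the left side IS `Σ_κ hessv R (W·κ)` for leaf-02-g4's full forward covariant Hessian `VariationalColourInterpolant.hessv` (p215238)
   — `sum_hessv_eq` (`rfl`) — i.e. leaf-01-g6's `hessV` of V-ONE-1F (p219386, `hessV := Σ_ν hessv (W·ν)`);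
 * §5 the curvature commutator is zeroth order, `Σ_{x,ν}‖commV W x ν‖² ≤ d²p²·nsqV W` (`nsq_commV_le`), hence **`nsq_roughOpV_le`**:
   `Σ_κ ‖(D†D W)_κ‖² ≤ 2·Σ_{x,ν}‖curlAdjCurlV W x ν + gradDivV W x ν‖² + 2d²p²·nsqV W` and the combined **`hessianV_le_el`**: the full covariant Hessian of a 1-form
   is controlled by the EL operator `curlAdjCurlV + gradDivV` of the Feynman-normalised form `½·curlSq + divSq` (= `VariationalVectorGarding.landauG 1`), the
   rough form and `p²·nsqV` — so the scalar REG⁺ mechanism (`VariationalCovariantRegularity`: multiplier structure at the constrained minimiser ⟹ the Laplacian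
   is form-bounded) has its vector entrance; for a general DATA `G` the EL operator is `curlAdjCurlV + ½∇G` and §2 isolates what `∇G` must control (`gradDivV`).

HONEST FRAMING (T4-DAG p. 1).  Model level; transports DATA (no identification with Bałaban's `U(Γ)` — c5); [folklore] exact operator identities + Cauchy–Schwarz;
nothing printed is a hypothesis; data `def`s of the four operators only, no `def … : Prop`, no `sorry`; axioms standard.  Row V-REG is NOT proved here (no
minimiser, no multiplier bound — that needs the vector KKT (V-D), V-ONE-1F's functional `rhoV` and the END's choice of `G`); NE2 NOT proved; spine PROVED 0∕9
unchanged; rung (B)+1 finite T⁴ — NOT infinite volume, NOT mass gap, NOT Clay.  HONEST DEPENDENCY (cell, verbatim): continuum YM on T⁴ ⇐ BetaPertH ∧ nine spine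
estimates (0/9 proved); BetaPertH ⇐ (D1) ∧ (D4) ∧ CAP+tail; G-an2-4 gates asym, D1 and NE2/3/4.
-/

noncomputable section

namespace Summit.QuantumFields.BalabanUV.T4Continuum.VariationalVectorBochner

open Finset
open scoped InnerProductSpace ComplexConjugate
open Literature.MathematicalPhysics.QuantumFieldTheory.Balaban1983to89.B5Prop11Plancherel (Tor fine unitVec)
open Summit.QuantumFields.BalabanUV.T4Continuum.VariationalColourFederbush (cDv dirUv)
open Summit.QuantumFields.BalabanUV.T4Continuum.VariationalColourInterpolant (hessv)
open Summit.QuantumFields.BalabanUV.T4Continuum.VariationalColourBochner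
  (nsqv nsqv_nonneg Dirv DirAdjv negLapv ipv ipv_self conj_ipv norm_ipv_le ipv_DirAdjv ipv_sum_right Dirv_sum DirAdjv_sub Dirv_DirAdjv_comm
   norm_kappa1v_le sum_sq_translate hessian_le)
open Summit.QuantumFields.BalabanUV.T4Continuum.VectorBlockTrialForm (nsqV nsqV_nonneg roughV roughV_nonneg)
open Summit.QuantumFields.BalabanUV.T4Continuum.VariationalVectorForm (cdV curlV curlSq curlSq_nonneg roughV_eq norm_sub_sq_le_two)
open Summit.QuantumFields.BalabanUV.T4Continuum.VariationalVectorWeitzenbock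
  (divV divSq cdV_eq_Dirv nsqV_eq_sum_nsqv rough_eq_sum_nsqv ipv_sub_right commutator_field_eq)

variable {d : ℕ} (N : Fin d → ℕ) [∀ μ, NeZero (N μ)]
variable {E : Type*} [NormedAddCommGroup E] [InnerProductSpace ℂ E] [CompleteSpace E]

/-! ## §1 The four operators on `E`-valued 1-forms -/

/-- the ROUGH (Bochner) Laplacian of a 1-form, componentwise: `(D†D W)_ν(x) = Σ_μ (D_μ†D_μ W_ν)(x)` (`VariationalColourBochner.negLapv` of the component). [folklore] -/
def roughOpV (R : Tor N → Fin d → (E →L[ℂ] E)) (W : Tor N → Fin d → E) (x : Tor N) (ν : Fin d) : E :=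
  negLapv N R (fun y => W y ν) x

/-- the HODGE part `(½·curl†curl W)_ν(x) = Σ_μ (D_μ† curl_{μν} W)(x)` (ordered pairs; the road's `curlV`). [folklore] -/
def curlAdjCurlV (R : Tor N → Fin d → (E →L[ℂ] E)) (W : Tor N → Fin d → E) (x : Tor N) (ν : Fin d) : E :=
  ∑ μ, DirAdjv N R μ (fun y => curlV N R W y μ ν) x

/-- the GRADIENT OF THE DIVERGENCE `(D div_R W)_ν(x) = (D_ν div_R W)(x)` (p218860's `divV`). [folklore] -/
def gradDivV (R : Tor N → Fin d → (E →L[ℂ] E)) (W : Tor N → Fin d → E) (x : Tor N) (ν : Fin d) : E :=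
  Dirv N R ν (divV N R W) x

/-- the CURVATURE COMMUTATOR `(comm W)_ν(x) = Σ_μ ([D_ν, D_μ†] W_μ)(x)` (operator coefficients `κ₁` = plaquette defects, `Dirv_DirAdjv_comm`). [folklore] -/
def commV (R : Tor N → Fin d → (E →L[ℂ] E)) (W : Tor N → Fin d → E) (x : Tor N) (ν : Fin d) : E :=
  ∑ μ, (Dirv N R ν (DirAdjv N R μ (fun y => W y μ)) x - DirAdjv N R μ (Dirv N R ν (fun y => W y μ)) x)

omit [∀ μ, NeZero (N μ)] in
/-- the rough operator's component is the colour Laplacian of the component (as fields). [folklore] -/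
theorem roughOpV_comp (R : Tor N → Fin d → (E →L[ℂ] E)) (W : Tor N → Fin d → E) (ν : Fin d) :
    (fun x => roughOpV N R W x ν) = negLapv N R (fun y => W y ν) := rfl

omit [∀ μ, NeZero (N μ)] [CompleteSpace E] in
/-- the curl in colour-carrier letters: `curl_{μν}W = D_μ(W·ν) − D_ν(W·μ)` as fields. [folklore] -/
theorem curlV_field_eq (R : Tor N → Fin d → (E →L[ℂ] E)) (W : Tor N → Fin d → E) (μ ν : Fin d) :
    (fun y => curlV N R W y μ ν) = fun y => Dirv N R μ (fun z => W z ν) y - Dirv N R ν (fun z => W z μ) y := rfl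

omit [∀ μ, NeZero (N μ)] [CompleteSpace E] in
/-- antisymmetry of the curl in the pair of directions. [folklore] -/
theorem curlV_swap (R : Tor N → Fin d → (E →L[ℂ] E)) (W : Tor N → Fin d → E) (y : Tor N) (μ ν : Fin d) :
    curlV N R W y ν μ = -curlV N R W y μ ν := by
  unfold curlV; exact (neg_sub _ _).symm

/-! ## §2 The operator Weitzenböck identity -/

omit [∀ μ, NeZero (N μ)] in
/-- **THE OPERATOR WEITZENBÖCK IDENTITY (exact, any transports, pointwise)**: `(D†D W)_ν(x) = (½curl†curl W)_ν(x) + (D_ν div W)(x) − Σ_μ([D_ν, D_μ†]W_μ)(x)`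
— since `D_μ†(D_μW_ν − D_νW_μ) + D_νD_μ†W_μ − (D_νD_μ† − D_μ†D_ν)W_μ = D_μ†D_μW_ν` term by term. [folklore] -/
theorem weitzenbockOp (R : Tor N → Fin d → (E →L[ℂ] E)) (W : Tor N → Fin d → E) (x : Tor N) (ν : Fin d) :
    roughOpV N R W x ν = curlAdjCurlV N R W x ν + gradDivV N R W x ν - commV N R W x ν := by
  unfold roughOpV curlAdjCurlV gradDivV commV negLapv
  have hcurl : ∀ μ, DirAdjv N R μ (fun y => curlV N R W y μ ν) x
      = DirAdjv N R μ (Dirv N R μ (fun y => W y ν)) x - DirAdjv N R μ (Dirv N R ν (fun y => W y μ)) x := by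
    intro μ; rw [curlV_field_eq, DirAdjv_sub]
  have hgrad : Dirv N R ν (divV N R W) x = ∑ μ, Dirv N R ν (DirAdjv N R μ (fun y => W y μ)) x := by
    have : divV N R W = fun y => ∑ μ, DirAdjv N R μ (fun z => W z μ) y := rfl
    rw [this, Dirv_sum]
  simp_rw [hcurl]
  rw [hgrad, ← sum_add_distrib, ← sum_sub_distrib]
  exact sum_congr rfl fun μ _ => by abel

omit [∀ μ, NeZero (N μ)] in
/-- the same identity as fields in `x`, for each component. [folklore] -/
theorem roughOpV_eq (R : Tor N → Fin d → (E →L[ℂ] E)) (W : Tor N → Fin d → E) (ν : Fin d) :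
    (fun x => roughOpV N R W x ν) = fun x => (curlAdjCurlV N R W x ν + gradDivV N R W x ν) - commV N R W x ν :=
  funext fun x => weitzenbockOp N R W x ν

/-! ## §3 The first-variation identities: `curlAdjCurlV` and `gradDivV` are the Euler–Lagrange operators of `½·curlSq` and `divSq` -/

omit [CompleteSpace E] in
/-- the pairing is subtractive in the first slot. [folklore] -/
theorem ipv_sub_left (f h g : Tor N → E) : ipv N (fun x => f x - h x) g = ipv N f g - ipv N h g := by
  unfold ipv; rw [← sum_sub_distrib]
  exact sum_congr rfl fun x _ => inner_sub_left _ _ _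

omit [CompleteSpace E] in
/-- the pairing against a negated field. [folklore] -/
theorem ipv_neg_right (g f : Tor N → E) : ipv N g (fun x => -f x) = -ipv N g f := by
  unfold ipv; rw [← sum_neg_distrib]
  exact sum_congr rfl fun x _ => inner_neg_right _ _

omit [CompleteSpace E] in
/-- additivity of the pairing in the first slot over a finite sum of fields. [folklore] -/
theorem ipv_sum_left {ι : Type*} (s : Finset ι) (F : ι → Tor N → E) (f : Tor N → E) :
    ipv N (fun x => ∑ i ∈ s, F i x) f = ∑ i ∈ s, ipv N (F i) f := by
  unfold ipv; rw [sum_comm]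
  exact sum_congr rfl fun x _ => sum_inner _ _ _

/-- the other adjointness: `⟨g, D_ν h⟩_{ℓ²} = ⟨D_ν† g, h⟩_{ℓ²}`. [folklore] -/
theorem ipv_Dirv_right (R : Tor N → Fin d → (E →L[ℂ] E)) (ν : Fin d) (g h : Tor N → E) :
    ipv N g (Dirv N R ν h) = ipv N (DirAdjv N R ν g) h := by
  rw [← conj_ipv N (Dirv N R ν h) g, ← ipv_DirAdjv, conj_ipv]

/-- **`Σ_ν ⟨V_ν, (½curl†curl W)_ν⟩_{ℓ²} = ½·Σ_{μ,ν} ⟨curl_{μν}V, curl_{μν}W⟩_{ℓ²}`** (adjointness, then the antisymmetry `curl_{νμ} = −curl_{μν}` folds the two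
halves of `curl V = D_μV_ν − D_νV_μ` onto each other). [folklore] -/
theorem sum_ipv_curlAdjCurlV (R : Tor N → Fin d → (E →L[ℂ] E)) (V W : Tor N → Fin d → E) :
    ∑ ν, ipv N (fun y => V y ν) (fun x => curlAdjCurlV N R W x ν)
      = (1 / 2 : ℂ) * ∑ μ, ∑ ν, ipv N (fun y => curlV N R V y μ ν) (fun y => curlV N R W y μ ν) := by
  -- left side through the adjoint: `Σ_ν Σ_μ ⟨D_μ V_ν, curl_{μν} W⟩`
  have hL : ∑ ν, ipv N (fun y => V y ν) (fun x => curlAdjCurlV N R W x ν)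
      = ∑ μ, ∑ ν, ipv N (Dirv N R μ (fun y => V y ν)) (fun y => curlV N R W y μ ν) := by
    rw [Finset.sum_comm]
    refine sum_congr rfl fun ν _ => ?_
    unfold curlAdjCurlV
    rw [ipv_sum_right]
    exact sum_congr rfl fun μ _ => ipv_DirAdjv N R μ _ _
  -- right side: `⟨curl V, curl W⟩ = ⟨D_μV_ν, curl_{μν}W⟩ − ⟨D_νV_μ, curl_{μν}W⟩`, and the second family is minus the first after `μ ↔ ν`
  have hR : ∑ μ, ∑ ν, ipv N (fun y => curlV N R V y μ ν) (fun y => curlV N R W y μ ν)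
      = ∑ μ, ∑ ν, ipv N (Dirv N R μ (fun y => V y ν)) (fun y => curlV N R W y μ ν)
        + ∑ μ, ∑ ν, ipv N (Dirv N R μ (fun y => V y ν)) (fun y => curlV N R W y μ ν) := by
    have h1 : ∀ μ ν, ipv N (fun y => curlV N R V y μ ν) (fun y => curlV N R W y μ ν)
        = ipv N (Dirv N R μ (fun y => V y ν)) (fun y => curlV N R W y μ ν) - ipv N (Dirv N R ν (fun y => V y μ)) (fun y => curlV N R W y μ ν) := by
      intro μ ν; rw [curlV_field_eq N R V, ipv_sub_left]
    have h2 : ∑ μ, ∑ ν, ipv N (Dirv N R ν (fun y => V y μ)) (fun y => curlV N R W y μ ν)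
        = -∑ μ, ∑ ν, ipv N (Dirv N R μ (fun y => V y ν)) (fun y => curlV N R W y μ ν) := by
      rw [Finset.sum_comm, ← sum_neg_distrib]
      refine sum_congr rfl fun μ _ => ?_
      rw [← sum_neg_distrib]
      refine sum_congr rfl fun ν _ => ?_
      rw [← ipv_neg_right]
      exact congrArg _ (funext fun y => curlV_swap N R W y μ ν)
    simp_rw [h1, sum_sub_distrib]
    rw [h2]; ring
  rw [hL, hR]; ring

/-- **`Σ_ν ⟨V_ν, (D div W)_ν⟩_{ℓ²} = ⟨div V, div W⟩_{ℓ²}`**. [folklore] -/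
theorem sum_ipv_gradDivV (R : Tor N → Fin d → (E →L[ℂ] E)) (V W : Tor N → Fin d → E) :
    ∑ ν, ipv N (fun y => V y ν) (fun x => gradDivV N R W x ν) = ipv N (divV N R V) (divV N R W) := by
  have hdiv : divV N R V = fun x => ∑ ν, DirAdjv N R ν (fun y => V y ν) x := rfl
  rw [hdiv, ipv_sum_left]
  refine sum_congr rfl fun ν _ => ?_
  exact ipv_Dirv_right N R ν _ _

/-- at `V = W`: `Σ_ν ⟨W_ν, (½curl†curl W)_ν⟩ = curlSq∕2` (a real number). [folklore] -/
theorem sum_ipv_curlAdjCurlV_self (R : Tor N → Fin d → (E →L[ℂ] E)) (W : Tor N → Fin d → E) :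
    ∑ ν, ipv N (fun y => W y ν) (fun x => curlAdjCurlV N R W x ν) = (((curlSq N R W / 2 : ℝ)) : ℂ) := by
  rw [sum_ipv_curlAdjCurlV]
  have hreal : curlSq N R W = ∑ μ, ∑ ν, nsqv N (fun y => curlV N R W y μ ν) := by
    unfold curlSq
    rw [Finset.sum_comm]
    refine sum_congr rfl fun μ _ => ?_
    rw [Finset.sum_comm]
    rfl
  have h : ∑ μ, ∑ ν, ipv N (fun y => curlV N R W y μ ν) (fun y => curlV N R W y μ ν) = ((curlSq N R W : ℝ) : ℂ) := by
    rw [hreal]; push_cast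
    exact sum_congr rfl fun μ _ => sum_congr rfl fun ν _ => ipv_self N _
  rw [h]; push_cast; ring

/-- at `V = W`: `Σ_ν ⟨W_ν, (D div W)_ν⟩ = divSq`. [folklore] -/
theorem sum_ipv_gradDivV_self (R : Tor N → Fin d → (E →L[ℂ] E)) (W : Tor N → Fin d → E) :
    ∑ ν, ipv N (fun y => W y ν) (fun x => gradDivV N R W x ν) = ((divSq N R W : ℝ) : ℂ) := by
  rw [sum_ipv_gradDivV, ipv_self]; rfl

/-! ## §4 Vector Bochner: the full covariant Hessian of a 1-form against its rough Laplacian -/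

/-- **VECTOR BOCHNER** (UNITARY transports, operator plaquette defect `≤ p`): summing `VariationalColourBochner.hessian_le` over the components,
`Σ_κ Σ_{μ,ν} ‖D_μD_νW_κ‖²_{ℓ²} ≤ 2·Σ_κ ‖(D†D W)_κ‖²_{ℓ²} + 2pd·Σ_{x,μ,κ}‖D_μW_κ(x)‖² + p²d²·nsqV W`. [folklore] -/
theorem hessianV_le {R : Tor N → Fin d → (E →L[ℂ] E)} (hU : ∀ x μ, R x μ ∈ unitary (E →L[ℂ] E)) {p : ℝ} (hp : 0 ≤ p)
    (hP : ∀ x μ ν, ‖R x μ * R (x + unitVec N μ) ν - R x ν * R (x + unitVec N ν) μ‖ ≤ p) (W : Tor N → Fin d → E) :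
    ∑ κ, ∑ μ, ∑ ν, nsqv N (Dirv N R μ (Dirv N R ν (fun y => W y κ)))
      ≤ 2 * ∑ κ, nsqv N (fun x => roughOpV N R W x κ) + 2 * p * d * ∑ x, ∑ μ, ∑ κ, ‖cdV N R W x μ κ‖ ^ 2 + p ^ 2 * d ^ 2 * nsqV N W := by
  have hκ : ∀ κ, ∑ μ, ∑ ν, nsqv N (Dirv N R μ (Dirv N R ν (fun y => W y κ)))
      ≤ 2 * nsqv N (fun x => roughOpV N R W x κ) + 2 * p * d * ∑ μ, nsqv N (Dirv N R μ (fun y => W y κ)) + p ^ 2 * d ^ 2 * nsqv N (fun y => W y κ) :=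
    fun κ => hessian_le N hU hp hP _
  have hrough : ∑ κ, ∑ μ, nsqv N (Dirv N R μ (fun y => W y κ)) = ∑ x, ∑ μ, ∑ κ, ‖cdV N R W x μ κ‖ ^ 2 := by
    rw [rough_eq_sum_nsqv, Finset.sum_comm]
  have hmass : ∑ κ, nsqv N (fun y => W y κ) = nsqV N W := by rw [nsqV_eq_sum_nsqv]; rfl
  calc _ ≤ ∑ κ, (2 * nsqv N (fun x => roughOpV N R W x κ) + 2 * p * d * ∑ μ, nsqv N (Dirv N R μ (fun y => W y κ))
          + p ^ 2 * d ^ 2 * nsqv N (fun y => W y κ)) := sum_le_sum fun κ _ => hκ κ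
    _ = _ := by rw [sum_add_distrib, sum_add_distrib, ← mul_sum, ← mul_sum, ← mul_sum, hrough, hmass]

/-- **ON THE LEVEL-`n` TORUS, with leaf-03-g4's rough form**: `Σ_κ Σ_{μ,ν} ‖D_μD_νW_κ‖² ≤ 2·Σ_κ ‖(D†D W)_κ‖² + 2pd·roughV n M R W + p²d²·nsqV W`. [folklore] -/
theorem hessianV_le_roughV (n : ℕ) [NeZero n] (M : Fin d → ℕ) [∀ μ, NeZero (M μ)] {R : Tor (fine n M) → Fin d → (E →L[ℂ] E)}
    (hU : ∀ x μ, R x μ ∈ unitary (E →L[ℂ] E)) {p : ℝ} (hp : 0 ≤ p)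
    (hP : ∀ x μ ν, ‖R x μ * R (x + unitVec (fine n M) μ) ν - R x ν * R (x + unitVec (fine n M) ν) μ‖ ≤ p) (W : Tor (fine n M) → Fin d → E) :
    ∑ κ, ∑ μ, ∑ ν, nsqv (fine n M) (Dirv (fine n M) R μ (Dirv (fine n M) R ν (fun y => W y κ)))
      ≤ 2 * ∑ κ, nsqv (fine n M) (fun x => roughOpV (fine n M) R W x κ) + 2 * p * d * roughV n M R W + p ^ 2 * d ^ 2 * nsqV (fine n M) W := by
  rw [roughV_eq]; exact hessianV_le (fine n M) hU hp hP W

omit [CompleteSpace E] in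
/-- **the left side in leaf-02-g4's letters**: `Σ_κ hessv R (W·κ) = Σ_κ Σ_{μ,ν} nsqv (D_μ D_ν (W·κ))` (`VariationalColourInterpolant.hessv`, BY NAME; `rfl`) —
so V-ONE-1F's `hessV W = Σ_ν hessv (W·ν)` is the quantity bounded by `hessianV_le`. [folklore] -/
theorem sum_hessv_eq (R : Tor N → Fin d → (E →L[ℂ] E)) (W : Tor N → Fin d → E) :
    ∑ κ, hessv N R (fun y => W y κ) = ∑ κ, ∑ μ, ∑ ν, nsqv N (Dirv N R μ (Dirv N R ν (fun y => W y κ))) := rfl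

/-! ## §5 The commutator is zeroth order; the rough Laplacian against the Euler–Lagrange operator -/

/-- **`Σ_{x,ν} ‖(comm W)_ν(x)‖² ≤ d²p²·nsqV W`** for UNITARY transports with plaquette defect `≤ p` (`‖κ₁‖ ≤ p`, Cauchy–Schwarz over `μ`, translation invariance). [folklore] -/
theorem nsq_commV_le {R : Tor N → Fin d → (E →L[ℂ] E)} (hU : ∀ x μ, R x μ ∈ unitary (E →L[ℂ] E)) {p : ℝ}
    (hP : ∀ x μ ν, ‖R x μ * R (x + unitVec N μ) ν - R x ν * R (x + unitVec N ν) μ‖ ≤ p) (W : Tor N → Fin d → E) :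
    ∑ x, ∑ ν, ‖commV N R W x ν‖ ^ 2 ≤ d ^ 2 * p ^ 2 * nsqV N W := by
  -- pointwise: `‖comm_ν(x)‖ ≤ Σ_μ p‖W_μ(x − e_μ + e_ν)‖`, squared with Cauchy–Schwarz over the `d` directions
  have hpt : ∀ x ν, ‖commV N R W x ν‖ ^ 2 ≤ d * ∑ μ, p ^ 2 * ‖W (x - unitVec N μ + unitVec N ν) μ‖ ^ 2 := by
    intro x ν
    have hle : ‖commV N R W x ν‖ ≤ ∑ μ, p * ‖W (x - unitVec N μ + unitVec N ν) μ‖ := by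
      unfold commV
      refine (norm_sum_le _ _).trans (sum_le_sum fun μ _ => ?_)
      rw [Dirv_DirAdjv_comm]
      exact (ContinuousLinearMap.le_opNorm _ _).trans (mul_le_mul_of_nonneg_right (norm_kappa1v_le N hU hP μ ν x) (norm_nonneg _))
    calc ‖commV N R W x ν‖ ^ 2 ≤ (∑ μ, p * ‖W (x - unitVec N μ + unitVec N ν) μ‖) ^ 2 := pow_le_pow_left₀ (norm_nonneg _) hle 2
      _ = (∑ μ, p * ‖W (x - unitVec N μ + unitVec N ν) μ‖ * 1) ^ 2 := by simp only [mul_one]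
      _ ≤ (∑ μ, (p * ‖W (x - unitVec N μ + unitVec N ν) μ‖) ^ 2) * ∑ _μ : Fin d, (1 : ℝ) ^ 2 := sum_mul_sq_le_sq_mul_sq _ _ _
      _ = d * ∑ μ, p ^ 2 * ‖W (x - unitVec N μ + unitVec N ν) μ‖ ^ 2 := by
          rw [one_pow, sum_const, card_univ, Fintype.card_fin, nsmul_eq_mul, mul_one, mul_comm]
          simp only [mul_pow]
  -- translation invariance per `(μ, ν)`, then count
  have htr : ∀ μ ν : Fin d, ∑ x, ‖W (x - unitVec N μ + unitVec N ν) μ‖ ^ 2 = ∑ x, ‖W x μ‖ ^ 2 := by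
    intro μ ν
    have := sum_sq_translate N (fun y => W y μ) (-unitVec N μ + unitVec N ν)
    rw [← this]
    exact sum_congr rfl fun x _ => by rw [← add_assoc, ← sub_eq_add_neg]
  calc ∑ x, ∑ ν, ‖commV N R W x ν‖ ^ 2 ≤ ∑ x, ∑ ν, (d * ∑ μ, p ^ 2 * ‖W (x - unitVec N μ + unitVec N ν) μ‖ ^ 2) :=
        sum_le_sum fun x _ => sum_le_sum fun ν _ => hpt x ν
    _ = ∑ x, ∑ ν, ∑ μ, (d * p ^ 2) * ‖W (x - unitVec N μ + unitVec N ν) μ‖ ^ 2 := by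
        refine sum_congr rfl fun x _ => sum_congr rfl fun ν _ => ?_
        rw [mul_sum]
        exact sum_congr rfl fun μ _ => by ring
    _ = ∑ ν, ∑ μ, (d * p ^ 2) * ∑ x, ‖W (x - unitVec N μ + unitVec N ν) μ‖ ^ 2 := by
        rw [Finset.sum_comm]
        refine sum_congr rfl fun ν _ => ?_
        rw [Finset.sum_comm]
        exact sum_congr rfl fun μ _ => (mul_sum _ _ _).symm
    _ = ∑ _ν : Fin d, (d * p ^ 2) * nsqV N W := by
        refine sum_congr rfl fun ν _ => ?_
        rw [nsqV_eq_sum_nsqv, mul_sum]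
        exact sum_congr rfl fun μ _ => by rw [htr μ ν]
    _ = d ^ 2 * p ^ 2 * nsqV N W := by rw [sum_const, card_univ, Fintype.card_fin, nsmul_eq_mul]; ring

/-- **THE ROUGH LAPLACIAN AGAINST THE EULER–LAGRANGE OPERATOR** (unitary transports, plaquette defect `≤ p`):
`Σ_κ ‖(D†D W)_κ‖²_{ℓ²} ≤ 2·Σ_{x,ν} ‖(½curl†curl W)_ν(x) + (D div W)_ν(x)‖² + 2d²p²·nsqV W` (§2 and `‖a − b‖² ≤ 2‖a‖² + 2‖b‖²`). [folklore] -/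
theorem nsq_roughOpV_le {R : Tor N → Fin d → (E →L[ℂ] E)} (hU : ∀ x μ, R x μ ∈ unitary (E →L[ℂ] E)) {p : ℝ}
    (hP : ∀ x μ ν, ‖R x μ * R (x + unitVec N μ) ν - R x ν * R (x + unitVec N ν) μ‖ ≤ p) (W : Tor N → Fin d → E) :
    ∑ κ, nsqv N (fun x => roughOpV N R W x κ)
      ≤ 2 * ∑ x, ∑ ν, ‖curlAdjCurlV N R W x ν + gradDivV N R W x ν‖ ^ 2 + 2 * (d ^ 2 * p ^ 2 * nsqV N W) := by
  have hcomm := nsq_commV_le N hU hP W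
  have hsum : ∑ κ, nsqv N (fun x => roughOpV N R W x κ) = ∑ x, ∑ κ, ‖roughOpV N R W x κ‖ ^ 2 := by
    unfold nsqv; exact Finset.sum_comm
  rw [hsum]
  calc ∑ x, ∑ κ, ‖roughOpV N R W x κ‖ ^ 2
      ≤ ∑ x, ∑ κ, (2 * ‖curlAdjCurlV N R W x κ + gradDivV N R W x κ‖ ^ 2 + 2 * ‖commV N R W x κ‖ ^ 2) := by
        refine sum_le_sum fun x _ => sum_le_sum fun κ _ => ?_
        rw [weitzenbockOp]
        exact norm_sub_sq_le_two _ _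
    _ = 2 * ∑ x, ∑ ν, ‖curlAdjCurlV N R W x ν + gradDivV N R W x ν‖ ^ 2 + 2 * ∑ x, ∑ ν, ‖commV N R W x ν‖ ^ 2 := by
        simp only [sum_add_distrib, mul_sum]
    _ ≤ _ := by linarith

/-- **THE COMBINED BOUND** (unitary transports, plaquette defect `≤ p`): the full covariant Hessian of a 1-form against the Euler–Lagrange operator of the
Feynman-normalised form `½·curlSq + divSq`, the rough form and the mass —
`Σ_κ Σ_{μ,ν} ‖D_μD_νW_κ‖² ≤ 4·Σ_{x,ν}‖(½curl†curl W + D div W)_ν(x)‖² + 2pd·Σ‖D_μW_κ‖² + 5p²d²·nsqV W`. [folklore] -/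
theorem hessianV_le_el {R : Tor N → Fin d → (E →L[ℂ] E)} (hU : ∀ x μ, R x μ ∈ unitary (E →L[ℂ] E)) {p : ℝ} (hp : 0 ≤ p)
    (hP : ∀ x μ ν, ‖R x μ * R (x + unitVec N μ) ν - R x ν * R (x + unitVec N ν) μ‖ ≤ p) (W : Tor N → Fin d → E) :
    ∑ κ, ∑ μ, ∑ ν, nsqv N (Dirv N R μ (Dirv N R ν (fun y => W y κ)))
      ≤ 4 * ∑ x, ∑ ν, ‖curlAdjCurlV N R W x ν + gradDivV N R W x ν‖ ^ 2 + 2 * p * d * ∑ x, ∑ μ, ∑ κ, ‖cdV N R W x μ κ‖ ^ 2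
        + 5 * (p ^ 2 * d ^ 2) * nsqV N W := by
  have h1 := hessianV_le N hU hp hP W
  have h2 := nsq_roughOpV_le N hU hP W
  nlinarith [h1, h2]

/-- the same on the level-`n` torus with `roughV`. [folklore] -/
theorem hessianV_le_el_roughV (n : ℕ) [NeZero n] (M : Fin d → ℕ) [∀ μ, NeZero (M μ)] {R : Tor (fine n M) → Fin d → (E →L[ℂ] E)}
    (hU : ∀ x μ, R x μ ∈ unitary (E →L[ℂ] E)) {p : ℝ} (hp : 0 ≤ p)
    (hP : ∀ x μ ν, ‖R x μ * R (x + unitVec (fine n M) μ) ν - R x ν * R (x + unitVec (fine n M) ν) μ‖ ≤ p) (W : Tor (fine n M) → Fin d → E) :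
    ∑ κ, ∑ μ, ∑ ν, nsqv (fine n M) (Dirv (fine n M) R μ (Dirv (fine n M) R ν (fun y => W y κ)))
      ≤ 4 * ∑ x, ∑ ν, ‖curlAdjCurlV (fine n M) R W x ν + gradDivV (fine n M) R W x ν‖ ^ 2 + 2 * p * d * roughV n M R W
        + 5 * (p ^ 2 * d ^ 2) * nsqV (fine n M) W := by
  rw [roughV_eq]; exact hessianV_le_el (fine n M) hU hp hP W

/-- **THE COMBINED BOUND IN `hessv` LETTERS** (the form V-ONE-1F's `hessV = Σ_ν hessv (W·ν)` consumes): UNITARY transports, plaquette defect `≤ p` ⟹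
`Σ_κ hessv R (W·κ) ≤ 4·Σ_{x,ν}‖(½curl†curl W + D div W)_ν(x)‖² + 2pd·roughV n M R W + 5p²d²·nsqV W` on the level-`n` torus. [folklore] -/
theorem sum_hessv_le_el (n : ℕ) [NeZero n] (M : Fin d → ℕ) [∀ μ, NeZero (M μ)] {R : Tor (fine n M) → Fin d → (E →L[ℂ] E)}
    (hU : ∀ x μ, R x μ ∈ unitary (E →L[ℂ] E)) {p : ℝ} (hp : 0 ≤ p)
    (hP : ∀ x μ ν, ‖R x μ * R (x + unitVec (fine n M) μ) ν - R x ν * R (x + unitVec (fine n M) ν) μ‖ ≤ p) (W : Tor (fine n M) → Fin d → E) :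
    ∑ κ, hessv (fine n M) R (fun y => W y κ)
      ≤ 4 * ∑ x, ∑ ν, ‖curlAdjCurlV (fine n M) R W x ν + gradDivV (fine n M) R W x ν‖ ^ 2 + 2 * p * d * roughV n M R W
        + 5 * (p ^ 2 * d ^ 2) * nsqV (fine n M) W := by
  rw [sum_hessv_eq]; exact hessianV_le_el_roughV n M hU hp hP W

end Summit.QuantumFields.BalabanUV.T4Continuum.VariationalVectorBochner

end
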